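import Mathlib
import Literature.Computability.AlgebraicComplexity.PIProof
import Literature.Computability.AlgebraicComplexity.ArithCircuit
import Literature.Computability.AlgebraicComplexity.ValiantClasses
import Summits.ValiantsHypothesis.ValiantsHypothesis.Theorems.ProofCarryingSymmetryRestorationQPVpFamilyPiCircuit
import Summits.ValiantsHypothesis.ValiantsHypothesis.Theorems.ProofCarryingSymmetryRestorationQPProvabilityNecessity

/-!
# Crux `RestorationQP` (stmt-ValiantsHypothesis-10343), line `registered`: W1⁻¹
`isVPFamily_of_piCircuits` — polynomial-size Hrubeš–Tzameret circuits of polynomial degree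
compute a VP family

The converse of stub W1 (`stub_vpFamily_piCircuit`, module
`…Theorems.ProofCarryingSymmetryRestorationQPVpFamilyPiCircuit`).  A Hrubeš–Tzameret circuit
`C : PICircuit k σ` (Hrubeš–Tzameret 2015, §1.1: a list of nodes `var x | const c | add i j |
mul i j` in topological order, children referenced by absolute position, a non-earlier reference
being junk that unfolds to the leaf `0`) is, node by node, a fan-in-two straight-line program in
Bürgisser's sense (`ArithCircuit`, Bürgisser 2000, Def. 2.1: gates `∑ aᵢ • uᵢ`, `∏ uᵢ` over
operands `var x | const c | gate j`, left-fold semantics `gateValues`, junk references read `0`):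
node `p` becomes gate `p` (`PiCircuitVp.gateOf`: `var x ↦ ∏ [x]`, `const c ↦ ∏ [c]`,
`add i j ↦ 1 • gate i + 1 • gate j`, `mul i j ↦ gate i * gate j`), the output operand reads the
last gate.  The two junk conventions agree, so the value lists coincide
(`PiCircuitVp.gateValues_map_gateOf`), whence `eval` is preserved (`PiCircuitVp.eval_toArithCircuit`),
the size is the same (`PiCircuitVp.size_toArithCircuit`) and `complexity Ĉ ≤ |C|`
(`PiCircuitVp.complexity_eval_le_size`).  The p-bounds `(n + 2) ^ c` are p-bounded
(`PiCircuitVp.isPBounded_add_two_pow`), and `#(Fin n × Fin n) = n² ≤ (n + 2)²`.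

With W1 this makes the registered provability stub T′ (`stub_invarianceProvableQP'`, hypothesis
"polynomial-size `PICircuit`s of polynomial degree") equivalent to its `IsVPFamily` form T_gen, and
with the lead's necessity theorem `invarianceProvableQP_of_restorationQP` (module
`…Theorems.ProofCarryingSymmetryRestorationQPProvabilityNecessity`: `RestorationQP → T_gen`) the
registered stub T′ is itself a consequence of the crux (`invarianceProvableQP'_of_restorationQP`).
Everything proved; no named facts.
-/

-- single-problem summit: `Summit.ValiantsHypothesis.ValiantsHypothesis.…` is the namespace by design (D-0017)
set_option linter.dupNamespace false

noncomputable section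

namespace Summit.ValiantsHypothesis.ValiantsHypothesis.Theorems

open MvPolynomial Literature.Computability.AlgebraicComplexity

namespace PiCircuitVp

open ArithCircuit PICircuit VpFamilyPiCircuit

variable {k : Type*} {σ : Type*} [CommSemiring k]

/-- The fan-in-two Bürgisser gate of a Hrubeš–Tzameret node: a leaf is a unary product, `add i j`
is the weighted sum `1 • gate i + 1 • gate j`, `mul i j` the product `gate i * gate j`. [folklore] -/
def gateOf : Node k σ → Gate k σ
  | .var x => .prod [.var x]
  | .const c => .prod [.const c]
  | .add i j => .sum [(1, .gate i), (1, .gate j)]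
  | .mul i j => .prod [.gate i, .gate j]

/-- The Bürgisser straight-line program of a Hrubeš–Tzameret circuit: node `p` becomes gate `p`,
the output operand reads the last gate (the output node). [folklore] -/
def toArithCircuit (C : PICircuit k σ) : ArithCircuit k σ where
  gates := C.nodes.map gateOf
  output := .gate C.body.length

/-- Every translated gate has at most two operands. [folklore] -/
theorem fanIn_gateOf_le (n : Node k σ) : (gateOf n : Gate k σ).fanIn ≤ 2 := by
  cases n <;> simp [gateOf, Gate.fanIn, Gate.args]

/-- The translated circuit has fan-in two. [folklore] -/
theorem isFanInTwo_toArithCircuit (C : PICircuit k σ) : (toArithCircuit C).IsFanInTwo := by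
  intro g hg
  obtain ⟨n, -, rfl⟩ := List.mem_map.1 hg
  exact fanIn_gateOf_le n

/-- The translation preserves the size: one gate per node. [folklore] -/
theorem size_toArithCircuit (C : PICircuit k σ) : (toArithCircuit C).size = C.size := by
  simp [toArithCircuit, ArithCircuit.size]

/-- A translated gate computes the value of the node (same junk value `0`). [folklore] -/
theorem eval_gateOf (vals : List (MvPolynomial σ k)) (n : Node k σ) :
    (gateOf n).eval vals = nodeVal vals n := by
  cases n <;> simp [gateOf, Gate.eval, nodeVal, Operand.eval]

/-- The node values of a body extended by one node. [folklore] -/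
theorem bodyVals_append_singleton (body : List (Node k σ)) (n : Node k σ) :
    bodyVals (body ++ [n]) = bodyVals body ++ [nodeVal (bodyVals body) n] := by
  simp only [bodyVals, unfoldList_append, unfoldList_cons, unfoldList_nil, List.map_append,
    List.map_cons, List.map_nil, eval_unfold]

/-- **The two left folds agree**: the gate values of the translated body are the node values
(induction along the body; both read junk references as `0`). [folklore] -/
theorem gateValues_map_gateOf (body : List (Node k σ)) :
    gateValues (body.map gateOf) = bodyVals body := by
  induction body using List.reverseRecOn with
  | nil => rfl
  | append_singleton body n ih =>
    rw [List.map_append, List.map_singleton, gateValues_append_singleton, ih, eval_gateOf,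
      bodyVals_append_singleton]

/-- **The translation is correct**: `toArithCircuit C` computes `Ĉ`. [folklore] -/
theorem eval_toArithCircuit (C : PICircuit k σ) : (toArithCircuit C).eval = C.eval := by
  change (Operand.gate C.body.length : Operand k σ).eval (gateValues (C.nodes.map gateOf)) = _
  rw [Operand.eval_gate, gateValues_map_gateOf, bodyVals,
    show (0 : MvPolynomial σ k) = (PIFormula.const (0 : k) : PIFormula k σ).eval by simp,
    List.getD_map, getD_unfoldList_nodes]
  rfl

/-- `L(Ĉ) ≤ |C|`: the straight-line complexity of the polynomial of a Hrubeš–Tzameret circuit is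
at most its number of nodes. [folklore] -/
theorem complexity_eval_le_size (C : PICircuit k σ) : complexity C.eval ≤ C.size :=
  Nat.sInf_le ⟨toArithCircuit C, isFanInTwo_toArithCircuit C, eval_toArithCircuit C,
    size_toArithCircuit C⟩

/-- `n ↦ (n + 2) ^ c` is p-bounded (`(n + 2) ^ c ≤ 2 ^ c (n + 1) ^ c`). [folklore] -/
theorem isPBounded_add_two_pow (c : ℕ) : IsPBounded fun n => (n + 2) ^ c :=
  (IsPBounded.iff_exists_le_mul_succ_pow _).2 ⟨2 ^ c, c, fun n =>
    calc (n + 2) ^ c ≤ (2 * (n + 1)) ^ c := Nat.pow_le_pow_left (by omega) c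
      _ = 2 ^ c * (n + 1) ^ c := mul_pow 2 (n + 1) c⟩

end PiCircuitVp

open PiCircuitVp in
/-- W1⁻¹ of crux `RestorationQP` (line `registered`): **a family of polynomial degree computed by
polynomial-size Hrubeš–Tzameret circuits is a VP family** — `#(Fin n × Fin n) = n² ≤ (n + 2)²`,
`deg fₙ ≤ (n + 2) ^ c`, and `L(fₙ) ≤ |Cₙ| ≤ (n + 2) ^ c` by the node-by-node translation
`PiCircuitVp.toArithCircuit` (Bürgisser 2000, Def. 2.1–2.4; Hrubeš–Tzameret 2015, §1.1); all three
bounds are p-bounded (`PiCircuitVp.isPBounded_add_two_pow`). [folklore] -/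
theorem isVPFamily_of_piCircuits : ∀ f : (n : ℕ) → MvPolynomial (Fin n × Fin n) ℂ, (∃ c : ℕ, ∀ n : ℕ, (f n).totalDegree ≤ (n + 2) ^ c ∧ ∃ C : PICircuit ℂ (Fin n × Fin n), C.eval = f n ∧ C.size ≤ (n + 2) ^ c) → IsVPFamily f := by
  rintro f ⟨c, hc⟩
  refine ⟨⟨(isPBounded_add_two_pow 2).mono fun n => ?_, (isPBounded_add_two_pow c).mono fun n =>
    (hc n).1⟩, (isPBounded_add_two_pow c).mono fun n => ?_⟩
  · rw [Fintype.card_prod, Fintype.card_fin, pow_two]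
    exact Nat.mul_le_mul (Nat.le_add_right n 2) (Nat.le_add_right n 2)
  · obtain ⟨C, hC, hCs⟩ := (hc n).2
    calc complexity (f n) = complexity C.eval := by rw [hC]
      _ ≤ C.size := complexity_eval_le_size C
      _ ≤ (n + 2) ^ c := hCs

/-- **The registered provability stub T′ follows from the crux**: `RestorationQP →
stub_invarianceProvableQP'` (statement verbatim) — by the lead's necessity theorem
`invarianceProvableQP_of_restorationQP` (`RestorationQP → T_gen`: a quasi-polynomial `S_n`-symmetric
circuit, laid out as a straight-line program, proves its own symmetry in `P_c(ℂ)`) composed with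
W1⁻¹ `isVPFamily_of_piCircuits` on the hypothesis side (Hrubeš–Tzameret 2015, §1.1;
Bürgisser 2000, Def. 2.1–2.4). [folklore] -/
theorem invarianceProvableQP'_of_restorationQP : Summit.ValiantsHypothesis.ValiantsHypothesis.Theses.ProofCarryingSymmetry.RestorationQP → ∀ f : (n : ℕ) → MvPolynomial (Fin n × Fin n) ℂ, (∀ (n : ℕ) (σ : Equiv.Perm (Fin n)), MvPolynomial.rename (fun x : Fin n × Fin n => σ • x) (f n) = f n) → (∃ c : ℕ, ∀ n : ℕ, (f n).totalDegree ≤ (n + 2) ^ c ∧ ∃ C : PICircuit ℂ (Fin n × Fin n), C.eval = f n ∧ C.size ≤ (n + 2) ^ c) → ∃ c : ℕ, ∀ n : ℕ, ∃ C : PICircuit ℂ (Fin n × Fin n), C.eval = f n ∧ C.size ≤ 2 ^ ((Nat.log 2 n + c) ^ c) ∧ ∀ σ : Equiv.Perm (Fin n), HasPCProofOfSize (C.rename fun x : Fin n × Fin n => σ • x) C (2 ^ ((Nat.log 2 n + c) ^ c)) :=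
  fun h f hinv hC => invarianceProvableQP_of_restorationQP h f hinv (isVPFamily_of_piCircuits f hC)

end Summit.ValiantsHypothesis.ValiantsHypothesis.Theorems
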